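import Summits.QuantumFields.YangMills.Theorems.UnitScaleTiltFluctuationComparisonRegPrGlobalSlackLocalToGlobalOnCount
import Summits.QuantumFields.YangMills.Theorems.UnitScaleTiltFluctuationComparisonRegPrGlobalSlackCanonicalOnChiChi
import Summits.QuantumFields.YangMills.Theorems.UnitScaleTiltFluctuationComparisonRegPrGlobalSlackCanonicalEndToEndChi
import Summits.QuantumFields.YangMills.Theorems.UnitScaleTiltFluctuationComparisonRegPrIntLChiV3Print
import Summits.QuantumFields.YangMills.Theorems.UnitScaleTiltFluctuationComparisonRegPrIntLT8OfV7Leaves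
import Summits.QuantumFields.YangMills.Theorems.UnitScaleTiltFluctuationComparisonRegPrAnsatzTStub
import HarnessLib

/-!
# `UnitScaleTiltFluctuationComparisonRegPrGlobalSlackCanonicalOnPrintChiChi` — THE SMALL-BLOCK ROW ON PRINT'S OWN χ-SETS ((i*)χ′, ★r1 g3's option): THE SIX CHART ROWS AT THE χ-RECORD'S
# CANONICAL POLYMERISATION WITH THE THREE CONFIGURATION ROWS READ ON `printChiSets` OF THE DATUM, AND THE CRUX FROM THEM (crux `FluctuationComparisonRegPrIntL`, stmt-QuantumFields-20520;
# OWNER RULING g23-№2 ADD. 6 keeps (i*)χ on `ChiGood` as the registered default — this file is the print-faithful OPTION (i*)χ′ of ★r1 g3's `…IntLChiV3Print` (p571077), typed to the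
# same depth; width-lever lane B «(R1) print's characteristic function χ of [Balaban1985UV3] (47) back», seat ym-ust-19935-r1 g4)

WHY.  Print never asks the configuration-dependent estimates ((28)/(44) size of the background in chart coordinates, its two-run comparison, the Taylor rest at it) off `χ_k` — the set of
fields whose regular minimiser `U_k(V)` obeys `|U_k(∂p) − 1| < g_k p(g_k)η²` ((47) p.267), typed as `printChiSets D b₀ p₀` over the datum's OWN minimiser (★r1 g2, p546995) and read at
the heights by `atHeights` (p545879).  The registered (i*)χ asks them on `PrintChi.ChiGood … ε₀ μ` (a margin-`μ` history-goodness, for every `ε₀`); ★r1 g3's engine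
`InteriorExcision.regPrIntL_of_v3ChiStubsPrint` accepts instead the row ON PRINT'S χ-SETS — no margin, no `ε₀`-family.  This file gives that row its chart-row reduction:

* §1 **`K1aChartRowsOnPrintChiKChi L 𝔠 a₀ a₁ a`** (hypothesis schema): NO letter on the record; per family / coupling / inhabited χ-package a coherent `p : ∀ K, PkgAtV3Chi` and ONE
  chart family with `TaylorSplitΦ (canonPTCore (toCore ∘ p))`, K1a `FlatKernelCauchyΦ`, `KernelSizeΦ` (decay `𝔠.κ`) and the three configuration rows `RemainderSmallΦOn`/`CfgSizeΦOn`/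
  `CfgCauchyΦOn` ON `atHeights (printChiSets D 𝔠.b₀ 𝔠.p₀)`, `D := dataOfV3chi p (canonPolymerCore (toCore ∘ p))` — the set where the minimiser's (68)-regularity holds BY DEFINITION;
* §2 `slackOnPrintChiAt_of_k1aChartRowsOnPrintChiKChi`, **`smallBlocksSlackOnPrintChi_of_k1aChartRowsOnPrintChiKChi : … → ⟨the (i*)χ′ hypothesis of `regPrIntL_of_v3ChiStubsPrint` VERBATIM⟩**
  (count-form On-producer `globalSupRateWSlackOn_of_chartsVolC` at `S := atHeights (printChiSets D b₀ p₀)`, weighted volume `locBlockVolumeC_canonCore`; threshold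
  `γB ⊓ gammaW ⊓ e^{2(1−p₀)}`, `σ := 7`);
* §3 **`regPrIntL_of_v7Leaves_recChi_k1aChartRowsPrintChi`** : V2′ → V3 → 2′χ → (`K1aChartRowsKChi`, odd `L ≥ 7`) → (`K1aChartRowsOnPrintChiKChi`, odd `1 < L < 7`) →
  `FluctuationComparisonRegPrIntL` — STUB 1 by `ApproxLift.AnsatzT.stub_oneStepSmallLift`, T8 by `thm1In8GlobalMin_of_v7Leaves`, engine ★r1 g3's Print variant.
Hypothesis schemas only; nothing of [Balaban1985UV3]/[King1986] is asserted; no numerics; registry untouched (`--supports stmt-QuantumFields-20520`).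

References: T. Bałaban, CMP 102 (1985) 255–275 [Balaban1985UV3] ((7) p.257, (24) p.262, (28)–(30) p.263, (43)–(47) pp.266–267, (57) p.270, (68) p.273); CMP 102 (1985) 277–309
[Balaban1985Variational] (Thm 1 (8) p.279, Prop. 7 p.299, Prop. 8 p.304); C. King, CMP 102 (1986) 649–677 [King1986] (Thm 3.4 (3.9) p.656, Prop. 3.6 (3.56) p.662); T. Bałaban, CMP 109
(1987) 249–301 [Balaban1987RG1] ((0.4) p.253).
-/

set_option autoImplicit false

noncomputable section

namespace Summit.QuantumFields.YangMills.Theorems.GlobalSlackCanonicalOnChi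

open scoped BigOperators
open MeasureTheory Filter
open Literature.MathematicalPhysics.QuantumFieldTheory.Balaban1983to89
open Literature.MathematicalPhysics.QuantumFieldTheory.Balaban1983to89.T3ContinuumYM3Torus
open Literature.MathematicalPhysics.QuantumFieldTheory.Balaban1983to89.T3UnitLawDensityEML (ℰp)
open Literature.MathematicalPhysics.QuantumFieldTheory.Balaban1983to89.T3UnitScaleTilt
open Literature.MathematicalPhysics.QuantumFieldTheory.Balaban1983to89.T3SmallLiftHistory (OneStepSmallLift)
open Literature.MathematicalPhysics.QuantumFieldTheory.Balaban1983to89.T3PrintedMinimiserExistence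
open Literature.MathematicalPhysics.QuantumFieldTheory.Balaban1983to89.T3LowerAlongMinimisersSplit (MinimisersIn8At)
open Literature.MathematicalPhysics.QuantumFieldTheory.Balaban1983to89.T3InteriorExcision
open Literature.MathematicalPhysics.QuantumFieldTheory.Balaban1983to89.T3AlphaInputsAC
open Literature.MathematicalPhysics.QuantumFieldTheory.Balaban1983to89.T3AlphaPolymerSocket
open Literature.MathematicalPhysics.QuantumFieldTheory.Balaban1983to89.T3AlphaInputsACTwoRun
open Literature.MathematicalPhysics.QuantumFieldTheory.Balaban1983to89.T3AlphaInputsACTwoRunLevel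
open Literature.MathematicalPhysics.QuantumFieldTheory.Balaban1983to89.T3Thm1Carrier (famX Idx)
open Literature.MathematicalPhysics.QuantumFieldTheory.Balaban1983to89.B12TreeDecay (kappa₀ K₀ K₀_pos kappa₀_nonneg)
open Literature.MathematicalPhysics.QuantumFieldTheory.Balaban1985CMP102
open Literature.MathematicalPhysics.QuantumFieldTheory.Balaban1985CMP102.Setting
open Summit.QuantumFields.Balaban3D.Carriers
open Summit.QuantumFields.Balaban3D.Proofs.Primitives
open Summit.QuantumFields.Balaban3D.Proofs.GroupModelLieC (lieC)
open Summit.QuantumFields.YangMills.Theorems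
open Summit.QuantumFields.YangMills.Theorems.GlobalSlackKernelMatching
open Summit.QuantumFields.YangMills.Theorems.GlobalSlackKernelMatchingOn
open Summit.QuantumFields.YangMills.Theorems.GlobalSlackLocalToGlobalOn
open Summit.QuantumFields.YangMills.Theorems.GlobalSlackCanonicalPolymers
open Summit.QuantumFields.YangMills.Theorems.LogComparisonRepAtHeightsOn (atHeights printChiSets)

/-! ## §1 The six chart rows at the χ-record's canonical polymerisation, the three configuration rows read on print's χ-sets of the datum -/

/-- **THE K1a CHART ROWS ON PRINT'S χ-SETS AT THE χ-RECORD'S CANONICAL POLYMERISATION, DECAY `𝔠.κ`, NO LETTER ON THE RECORD** (hypothesis schema, never asserted): nonnegative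
constants, a threshold, and for every family / coupling / inhabited χ-package a coherent `p : ∀ K, PkgAtV3Chi …` and ONE chart family with `TaylorSplitΦ (canonPTCore (toCore ∘ p))`, K1a
`FlatKernelCauchyΦ`, `KernelSizeΦ` on the whole window and `RemainderSmallΦOn`/`CfgSizeΦOn`/`CfgCauchyΦOn (ℓ ≡ 1)` ON `atHeights (printChiSets D 𝔠.b₀ 𝔠.p₀)` — print's own χ_k-sets of
the datum `D := dataOfV3chi p (canonPolymerCore (toCore ∘ p))` ((47): `|U_k(∂p) − 1| < g_k p(g_k)η²` for the datum's minimiser).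
[cite: Balaban1985UV3, (25) p.262, (28)-(30) p.263, (33)-(34) p.264, (43)-(47) pp.266-267; King1986, Thm 3.4 (3.9) p.656, Prop. 3.6 (3.56) p.662] -/
def K1aChartRowsOnPrintChiKChi (L : ℕ) (𝔠 : AlphaConsts L (suGroupModel 2).N) (a₀ a₁ a : ℝ) : Prop :=
  ∃ (C C_E C_R C_s C_B γB : ℝ), 0 ≤ C ∧ 0 ≤ C_E ∧ 0 ≤ C_R ∧ 0 ≤ C_s ∧ 0 ≤ C_B ∧ 0 < γB ∧
    ∀ (F : T3Family) (γ : ℝ) (hF : F.L = L) (hγ : 0 < γ), γ ≤ γB → ∀ (hγ1 : γ ≤ (min (hF ▸ 𝔠).gamma0 1) ^ 2),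
      AlphaInputsT3AC.OfV3ChiAt F (hF ▸ 𝔠) a₀ a₁ →
        ∃ (p : ∀ K, AlphaInputsT3AC.PkgAtV3Chi F (hF ▸ 𝔠) γ hγ hγ1 K), (∀ K, (p K).a₀ = a₀ ∧ (p K).a₁ = a₁) ∧
          ∃ (Φ : ChartFam ↥(lieC (suGroupModel 2)) F) (e : VacFam F) (B : CfgFam ↥(lieC (suGroupModel 2)) F) (R : RemFam F),
            TaylorSplitΦ (canonPTCore fun K => (p K).toCore) Φ e B R ∧
            FlatKernelCauchyΦ (AlphaInputsT3AC.dataOfV3chi p (canonPolymerCore fun K => (p K).toCore)) Φ (hF ▸ 𝔠).κ a C ∧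
            KernelSizeΦ (AlphaInputsT3AC.dataOfV3chi p (canonPolymerCore fun K => (p K).toCore)) Φ (hF ▸ 𝔠).κ C_E ∧
            RemainderSmallΦOn (atHeights (printChiSets (AlphaInputsT3AC.dataOfV3chi p (canonPolymerCore fun K => (p K).toCore)) (hF ▸ 𝔠).b₀ (hF ▸ 𝔠).p₀))
              (AlphaInputsT3AC.dataOfV3chi p (canonPolymerCore fun K => (p K).toCore)) R (hF ▸ 𝔠).b₀ (hF ▸ 𝔠).p₀ (hF ▸ 𝔠).κ C_R ∧
            CfgSizeΦOn (atHeights (printChiSets (AlphaInputsT3AC.dataOfV3chi p (canonPolymerCore fun K => (p K).toCore)) (hF ▸ 𝔠).b₀ (hF ▸ 𝔠).p₀))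
              (AlphaInputsT3AC.dataOfV3chi p (canonPolymerCore fun K => (p K).toCore)) B (hF ▸ 𝔠).b₀ (hF ▸ 𝔠).p₀ C_s ∧
            CfgCauchyΦOn (atHeights (printChiSets (AlphaInputsT3AC.dataOfV3chi p (canonPolymerCore fun K => (p K).toCore)) (hF ▸ 𝔠).b₀ (hF ▸ 𝔠).p₀))
              (AlphaInputsT3AC.dataOfV3chi p (canonPolymerCore fun K => (p K).toCore)) B (hF ▸ 𝔠).b₀ (hF ▸ 𝔠).p₀ a C_B fun _ => 1

/-- The full-window χ-chart rows at the record's decay rate give the rows on print's χ-sets (`…On_of_full`). [cite: Balaban1985UV3, (47) p.267] -/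
theorem k1aChartRowsOnPrintChiKChi_of_chartRowsKChi {L : ℕ} {𝔠 : AlphaConsts L (suGroupModel 2).N} {a₀ a₁ a : ℝ} (h : K1aChartRowsKChi L 𝔠 a₀ a₁ a) :
    K1aChartRowsOnPrintChiKChi L 𝔠 a₀ a₁ a := by
  obtain ⟨C, C_E, C_R, C_s, C_B, γB, hC, hCE, hCR, hCs, hCB, hγB, hall⟩ := h
  refine ⟨C, C_E, C_R, C_s, C_B, γB, hC, hCE, hCR, hCs, hCB, hγB, fun F γ hF hγ hγle hγ1 hOf => ?_⟩
  obtain ⟨p, hp, Φ, e, B, R, hT, hK, hE, hR, hS, hBC⟩ := hall F γ hF hγ hγle hγ1 hOf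
  exact ⟨p, hp, Φ, e, B, R, hT, hK, hE, remainderSmallΦOn_of_full _ hR, cfgSizeΦOn_of_full _ hS, cfgCauchyΦOn_of_full _ hBC⟩

/-! ## §2 The small-block slack row on print's χ-sets from the rows, by name -/

/-- **ONE BLOCK SIZE**: `K1aChartRowsOnPrintChiKChi L` for every record ⟹ the (i*)χ′-clause at `L` — threshold `γB ⊓ gammaW L 𝔠 C_s C_B ⊓ e^{2(1−p₀)}`, `π := canonPolymerCore (toCore ∘ p)`,
`σ := 7`; the count-form On-producer `globalSupRateWSlackOn_of_chartsVolC` at `S := atHeights (printChiSets D b₀ p₀)` over the five core producer theorems (weighted volume, no letter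
on `M₁`), windows from `γ` small, bridge `printChi_globalSupRateTSlackOn_iff_W`. [cite: Balaban1985UV3, (7) p.257, (24) p.262, (43)-(47) pp.266-267, (57) p.270; King1986, Thm 3.4 (3.9) p.656, Prop. 3.6 p.662] -/
theorem slackOnPrintChiAt_of_k1aChartRowsOnPrintChiKChi (L : ℕ)
    (h : ∀ (𝔠 : AlphaConsts L (suGroupModel 2).N) (a₀ a₁ : ℝ),
      0 < a₀ → 0 < a₁ → 𝔠.B₃ * a₁ ≤ a₀ → ∃ a : ℝ, 0 < a ∧ a < 1 ∧ K1aChartRowsOnPrintChiKChi L 𝔠 a₀ a₁ a) :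
    ∀ (𝔠 : Summit.QuantumFields.Balaban3D.Proofs.Primitives.AlphaConsts L (Summit.QuantumFields.Balaban3D.Carriers.suGroupModel 2).N)
      (a₀ a₁ : ℝ), 0 < a₀ → 0 < a₁ → 𝔠.B₃ * a₁ ≤ a₀ →
      ∃ a : ℝ, 0 < a ∧ ∃ γB : ℝ, 0 < γB ∧ ∀ (F : T3Family) (γ : ℝ) (hF : F.L = L) (hγ : 0 < γ), γ ≤ γB →
        ∀ (hγ1 : γ ≤ (min (hF ▸ 𝔠).gamma0 1) ^ 2),
          Summit.QuantumFields.YangMills.Theorems.AlphaInputsT3AC.OfV3ChiAt F (hF ▸ 𝔠) a₀ a₁ →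
          ∃ (p : ∀ K, Summit.QuantumFields.YangMills.Theorems.AlphaInputsT3AC.PkgAtV3Chi F (hF ▸ 𝔠) γ hγ hγ1 K),
            (∀ K, (p K).a₀ = a₀ ∧ (p K).a₁ = a₁) ∧
            ∃ (π : Summit.QuantumFields.YangMills.Theorems.AlphaInputsT3AC.PolymerT3 F) (σ : ℕ) (C : ℝ), 7 ≤ σ ∧ 0 ≤ C ∧
              Summit.QuantumFields.YangMills.Theorems.PrintChi.GlobalSupRateTSlackOn
                (atHeights (printChiSets (Summit.QuantumFields.YangMills.Theorems.AlphaInputsT3AC.dataOfV3chi p π) (hF ▸ 𝔠).b₀ (hF ▸ 𝔠).p₀))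
                (Summit.QuantumFields.YangMills.Theorems.AlphaInputsT3AC.dataOfV3chi p π) (hF ▸ 𝔠).b₀ (hF ▸ 𝔠).p₀ a σ C := by
  intro 𝔠 a₀ a₁ ha0 ha1 hw
  obtain ⟨a, ha, ha1', C, C_E, C_R, C_s, C_B, γB, hC, hCE, hCR, hCs, hCB, hγB, hall⟩ := h 𝔠 a₀ a₁ ha0 ha1 hw
  obtain ⟨hκ0, hκ₀⟩ := kappa_record_admissible 𝔠
  refine ⟨a, ha, min γB (min (gammaW L 𝔠 C_s C_B) (Real.exp (2 * (1 - 𝔠.p₀)))),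
    lt_min hγB (lt_min (gammaW_pos L 𝔠 C_s C_B) (Real.exp_pos _)), fun F γ hF hγ hγle hγ1 hOf => ?_⟩
  subst hF
  have hγB' : γ ≤ γB := hγle.trans (min_le_left _ _)
  have hW : γ ≤ gammaW F.L 𝔠 C_s C_B := hγle.trans ((min_le_right _ _).trans (min_le_left _ _))
  have hγe : Real.sqrt γ ≤ Real.exp (1 - 𝔠.p₀) :=
    sqrt_le_exp_of_le (hγle.trans ((min_le_right _ _).trans (min_le_right _ _)))
  have h0 : γ ≤ gammaθ 𝔠.b₀ 𝔠.p₀ (1 / max 1 (C_s + C_B)) := hW.trans (min_le_left _ _)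
  have h1 : γ ≤ gammaθ 𝔠.b₀ (𝔠.p₀ + 𝔠.r₀) (𝔠.ρ / (4 * max 1 𝔠.cB)) := hW.trans ((min_le_right _ _).trans (min_le_left _ _))
  have h2 : γ ≤ gammaθ 𝔠.b₀ 𝔠.p₀ (1 / (2 * (8 * ((F.L : ℝ) + 1) ^ 2 * 𝔠.B₃ * 𝔠.Zfull))) := hW.trans ((min_le_right _ _).trans (min_le_right _ _))
  have hγ1' : γ ≤ 1 := hγ1.trans (sq_min_one_le _ 𝔠.gamma0_pos)
  have hwin : ∀ n, (C_s + C_B) * θBal F.L γ 𝔠.b₀ 𝔠.p₀ n ≤ 1 := fun n => window_sum_le_one F.hL.2.le 𝔠.b₀_pos 𝔠.p₀_pos hγ hγ1' h0 n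
  obtain ⟨p, hp, Φ, e, B, R, hT, hK, hE, hR, hS, hBC⟩ := hall F γ rfl hγ hγB' hγ1 hOf
  set q : ∀ K, AlphaInputsT3AC.PkgCoreV3 F 𝔠 γ hγ hγ1 K := fun K => (p K).toCore
  have hw1 := fun K k hk => window_jet (hγ := hγ) (hγ1 := hγ1) h1 K k hk
  have hw2 := fun K k hk => window_oldSlice (hγ := hγ) (hγ1 := hγ1) h2 K k hk
  have hCT : 0 ≤ max (newConst 𝔠) (oldConst 𝔠 * (F.L : ℝ) ^ 4 * Real.exp (𝔠.κ * (F.L : ℝ) ^ 3)) := le_max_of_le_left (newConst_nonneg 𝔠)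
  have hC₁ : 0 ≤ 5 * (C_s ^ 2 * C + 6 * C_s * C_B * C_E) + 2 * C_R := by positivity
  have hG := globalSupRateWSlackOn_of_chartsVolC
    (atHeights (printChiSets (AlphaInputsT3AC.dataOfV3chi p (canonPolymerCore q)) 𝔠.b₀ 𝔠.p₀))
    hγ hγ1' hγe 𝔠.b₀_pos 𝔠.p₀_pos.le ha ha1' hC hCE hCR hCs hCB hCT hwin
    (pintDecompTrivT_canonCore q) (locCover_canonCore q hκ0.le hκ₀) (locBlockVolumeC_canonCore q) (locMatched_canonCore q)
    (termSizeTrivT_canonCore q hκ0 le_rfl hw1 hw2) hT hK hE hR hS hBC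
  exact ⟨p, hp, canonPolymerCore q, 7, _, le_rfl,
    producerConstC_nonneg F (C' := max 1 (K₀ (4 * 2 ^ 3) (2 * 3))) ha1' hC₁ hCT (volWeight_canon_pos 𝔠),
    (printChi_globalSupRateTSlackOn_iff_W _ _ _ _ _ _ _).2 hG⟩

/-- **THE (i*)χ′ HYPOTHESIS OF ★r1 g3's PRINT ENGINE FROM THE ROWS ON PRINT'S χ-SETS, BY NAME**: if for every odd `1 < L < 7`, every constants record and [7]-constants there is `0 < a < 1` with
`K1aChartRowsOnPrintChiKChi L 𝔠 a₀ a₁ a`, then the `hI` of `InteriorExcision.regPrIntL_of_v3ChiStubsPrint` (p571077) holds VERBATIM. [cite: Balaban1985UV3, (47) p.267, (57) p.270; King1986, Thm 3.4 (3.9) p.656, Prop. 3.6 p.662] -/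
theorem smallBlocksSlackOnPrintChi_of_k1aChartRowsOnPrintChiKChi
    (h : ∀ (L : ℕ), Odd L → 1 < L → L < 7 → ∀ (𝔠 : AlphaConsts L (suGroupModel 2).N) (a₀ a₁ : ℝ),
      0 < a₀ → 0 < a₁ → 𝔠.B₃ * a₁ ≤ a₀ → ∃ a : ℝ, 0 < a ∧ a < 1 ∧ K1aChartRowsOnPrintChiKChi L 𝔠 a₀ a₁ a) :
    ∀ (L : ℕ), Odd L → 1 < L → L < 7 →
      ∀ (𝔠 : Summit.QuantumFields.Balaban3D.Proofs.Primitives.AlphaConsts L (Summit.QuantumFields.Balaban3D.Carriers.suGroupModel 2).N)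
        (a₀ a₁ : ℝ), 0 < a₀ → 0 < a₁ → 𝔠.B₃ * a₁ ≤ a₀ →
        ∃ a : ℝ, 0 < a ∧ ∃ γB : ℝ, 0 < γB ∧ ∀ (F : T3Family) (γ : ℝ) (hF : F.L = L) (hγ : 0 < γ), γ ≤ γB →
          ∀ (hγ1 : γ ≤ (min (hF ▸ 𝔠).gamma0 1) ^ 2),
            Summit.QuantumFields.YangMills.Theorems.AlphaInputsT3AC.OfV3ChiAt F (hF ▸ 𝔠) a₀ a₁ →
            ∃ (p : ∀ K, Summit.QuantumFields.YangMills.Theorems.AlphaInputsT3AC.PkgAtV3Chi F (hF ▸ 𝔠) γ hγ hγ1 K),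
              (∀ K, (p K).a₀ = a₀ ∧ (p K).a₁ = a₁) ∧
              ∃ (π : Summit.QuantumFields.YangMills.Theorems.AlphaInputsT3AC.PolymerT3 F) (σ : ℕ) (C : ℝ), 7 ≤ σ ∧ 0 ≤ C ∧
                Summit.QuantumFields.YangMills.Theorems.PrintChi.GlobalSupRateTSlackOn
                  (atHeights (printChiSets (Summit.QuantumFields.YangMills.Theorems.AlphaInputsT3AC.dataOfV3chi p π) (hF ▸ 𝔠).b₀ (hF ▸ 𝔠).p₀))
                  (Summit.QuantumFields.YangMills.Theorems.AlphaInputsT3AC.dataOfV3chi p π) (hF ▸ 𝔠).b₀ (hF ▸ 𝔠).p₀ a σ C :=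
  fun L hLo hL1 hL7 => slackOnPrintChiAt_of_k1aChartRowsOnPrintChiKChi L (h L hLo hL1 hL7)

/-! ## §3 The crux from the leaves, the χ-record and the chart rows — print's-χ variant -/

/-- **THE DECIDING CRUX FROM 19200's TWO LEAVES, THE χ-RECORD, THE χ-CHART ROWS (`L ≥ 7`) AND THE ROWS ON PRINT'S χ-SETS (`L < 7`)** — ★r1 g3's print engine
`InteriorExcision.regPrIntL_of_v3ChiStubsPrint` with STUB 1 := `ApproxLift.AnsatzT.stub_oneStepSmallLift`, T8 := `InteriorExcision.thm1In8GlobalMin_of_v7Leaves hV2 hV3`, 3⁗χ :=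
`globalTwoRunSlackFamChi_of_k1aChartRowsKChi h3`, (i*)χ′ := `smallBlocksSlackOnPrintChi_of_k1aChartRowsOnPrintChiKChi hI`.  NO letter on the record anywhere, no margin `μ`, no `ε₀`-family.
[cite: Balaban1985UV3, (41) p.266, (43)-(47) pp.266-267, Thm 2 p.272; Balaban1985Variational, Thm 1 (8) p.279, Prop. 7 p.299, Prop. 8 p.304; King1986, Thm 3.4 (3.9) p.656; Balaban1987RG1, (0.4) p.253] -/
theorem regPrIntL_of_v7Leaves_recChi_k1aChartRowsPrintChi
    (hV2 : ∀ (L : ℕ), 1 < L → ∃ B₃ : ℝ, 4 < B₃ ∧ ∃ a₅ : ℝ, 0 < a₅ ∧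
      ∀ (i : Idx L) (ε₀ ε₁ : ℝ), 0 < ε₁ → ∀ (V : (famX L i).Bdry) (U : (famX L i).Cfg), (famX L i).Reg7 ε₁ V → (famX L i).InU ε₀ U →
        (famX L i).InB V U → (famX L i).IsCritical V U → ε₀ ≤ a₅ → (famX L i).InU (max (B₃ * ε₁) (ε₀ / 2)) U)
    (hV3 : ∀ (L : ℕ), 1 < L → ∀ B₃ : ℝ, 4 < B₃ →
      ∃ a₀ a₁' O₁ : ℝ, 0 < a₀ ∧ 0 < a₁' ∧ 1 ≤ O₁ ∧ ∀ (i : Idx L) (ε₀ ε₁ : ℝ), 0 < ε₁ → ∀ V : (famX L i).Bdry, (famX L i).Reg7 ε₁ V →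
        ∀ U₀ : (famX L i).Cfg, (famX L i).InU ((L : ℝ) ^ 3 * B₃ * ε₁) U₀ → (famX L i).InB V U₀ →
          (ε₀ ≤ a₀ → B₃ * ε₁ ≤ ε₀ → (famX L i).AtMostOneCriticalOrbit ε₀ V) ∧
          (ε₁ ≤ a₁' → ∃ U : (famX L i).Cfg, (famX L i).OnMinimalOrbit (O₁ * (L : ℝ) ^ 3 * B₃ * ε₁) V U))
    (h2 : ∀ L : ℕ, Odd L → 1 < L → Summit.QuantumFields.YangMills.Theorems.AlphaInputsT3ACv3RecChi L)
    (h3 : ∀ (L : ℕ), Odd L → 7 ≤ L → ∀ (𝔠 : AlphaConsts L (suGroupModel 2).N) (a₀ a₁ : ℝ), 0 < a₀ → 0 < a₁ → 𝔠.B₃ * a₁ ≤ a₀ →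
      ∃ a : ℝ, 0 < a ∧ a < 1 ∧ K1aChartRowsKChi L 𝔠 a₀ a₁ a)
    (hI : ∀ (L : ℕ), Odd L → 1 < L → L < 7 → ∀ (𝔠 : AlphaConsts L (suGroupModel 2).N) (a₀ a₁ : ℝ),
      0 < a₀ → 0 < a₁ → 𝔠.B₃ * a₁ ≤ a₀ → ∃ a : ℝ, 0 < a ∧ a < 1 ∧ K1aChartRowsOnPrintChiKChi L 𝔠 a₀ a₁ a) :
    FluctuationComparisonRegPrIntL :=
  InteriorExcision.regPrIntL_of_v3ChiStubsPrint Summit.QuantumFields.YangMills.Theorems.ApproxLift.AnsatzT.stub_oneStepSmallLift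
    (InteriorExcision.thm1In8GlobalMin_of_v7Leaves hV2 hV3) h2 (globalTwoRunSlackFamChi_of_k1aChartRowsKChi h3)
    (smallBlocksSlackOnPrintChi_of_k1aChartRowsOnPrintChiKChi hI)

end Summit.QuantumFields.YangMills.Theorems.GlobalSlackCanonicalOnChi

end
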